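import Literature.Analysis.Complex.RiemannSphereChartTransplant
import Literature.Analysis.Complex.RiemannSphereDbarKernel
import Literature.Analysis.Complex.RiemannSphereSectionOperators
import Literature.Analysis.Complex.CauchyTransformHolderHigher
import Literature.Analysis.Complex.CauchyTransformHolder
import Literature.Analysis.Complex.CauchyTransformSupport
import HarnessLib

/-!
# A bounded right inverse of `∂̄` on Hölder sections of `O(n)` over the Riemann sphere

Topic `Literature/Analysis/Complex`. In the two-chart description `S² = ℂ_z ∪ ℂ_w` (`w = z⁻¹`) of
`Literature/Analysis/Complex/RiemannSphereHolderSections.lean`, the holomorphic line bundle `O(n)`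
is the bundle with clutching function `τ w = ε wⁿ` (`ε ≠ 0` a normalisation: `ε = 1`, `n = 0` the
functions; `ε = -1`, `n = 2` the tangent bundle `ξ₁ w = -w² ξ₀ w⁻¹`), and the `(0,1)`-forms with
values in `O(n)` have clutching `τ' w = -ε wⁿ (w̄)⁻²`
(since `∂̄_w (f₀ (w⁻¹)) = -(w̄)⁻² (∂̄ f₀)(w⁻¹)`).
For `0 < r < 1` and a finite-dimensional complex Banach space `F` we construct a continuous linear
map

  `R : 𝓗^{k,r}_{τ'}(F) →L[ℝ] 𝓗^{k+1,r}_{τ}(F)`  with  `∂̄ (sec₀ τ (R η)) = sec₀ τ' η`,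
  `∂̄ (sec₁ τ (R η)) = sec₁ τ' η`  on `ℂ`

(`RiemannSphere.dbarRightInv`, `RiemannSphere.exists_dbar_rightInverse`; the cases `τ = 1` and
`τ w = -w²` in the tree's syntactic forms: `exists_dbar_rightInverse_one`,
`exists_dbar_rightInverse_neg_sq`): the Dolbeault isomorphism `H^{0,1}(ℂℙ¹, O(n)) = 0` in Hölder
classes, the surjectivity input of the
implicit-function-theorem construction of embedded `J`-holomorphic spheres (Wendl 2018, §2.1.3,
Thm. 2.46, Prop. 2.53). The kernel (`= polynomials of degree ≤ n`) is
`Literature/Analysis/Complex/RiemannSphereDbarKernel.lean`.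

## Construction

Split a density `η = (g₀, g₁)` as `χ η + (1 - χ) η` with the cutoff `χ` of
`Literature/Analysis/Complex/RiemannSphereChartTransplant.lean` (`= 1` on `‖z‖ ≤ 1`, `= 0` on
`‖z‖ ≥ 2`; `1 - χ` read in the `w`-chart is `χ'`, supported in `‖w‖ ≤ 1`). The two compactly
supported densities `densA η = χ • g₀` (in the `z`-chart) and `densB η = χ' • g₁` (in the
`w`-chart) are solved by the Cauchy transform `T` (`cauchyTransform_contDiffHolder_succ`:
`T : C^{k,r}_c → C^{k+1,r}_b`, `∂̄ T = id`, `T g → 0` at infinity, with the a priori estimate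
`cauchyTransformHolderApriori_of_lt_one`), and each solution is transplanted to the other chart
(`RiemannSphere.transplant`, holomorphic near the origin by the removable singularity theorem):

  `rep₀ η = T (densA η) + transplant_{ε⁻¹ zⁿ} (T (densB η))`,
  `rep₁ η = transplant_{ε wⁿ} (T (densA η)) + T (densB η)`,

a clutched pair (`rep₁_eq_smul_rep₀`) whose pieces `(ρ • rep₀ η, ρ • rep₁ η)` lie in
`C^{k+1,r}_b` (`memContDiffHolder_rhoCut_smul_rep₀`). Linearity is that of `T`; continuity is the
closed graph theorem (`ContDiffHolderFunction.clmOfContinuousEval`: the point evaluations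
`η ↦ T (χ g₀)(z)` are bounded by `12 ‖g₀‖`). The identity `∂̄ rep₀ η = sec₀ τ' η`
(`dbarAlong_rep₀`) is `∂̄ T = id`, the chain rule under inversion, the clutching relation of `η`
and the partition identity `χ ρ + (1 - χ) (ρ ∘ (·)⁻¹) = 1`.

## References

* C. Wendl, *Holomorphic Curves in Low Dimensions*, LNM 2216 (2018), §2.1.3, Thm. 2.46,
  Prop. 2.53. [Wendl2018]
* D. McDuff, D. Salamon, *J-holomorphic curves and symplectic topology*, 2nd ed. (2012), App. C.
  [McDuffSalamon2012]
* L. Hörmander, *An Introduction to Complex Analysis in Several Variables*, 2nd ed. (1973),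
  Thm. 1.2.2. [HormanderSCV1973]
-/

noncomputable section

open Set Filter Metric Function
open scoped Topology NNReal ContDiff

namespace Literature.Analysis.Complex

open _root_.Complex Literature.Analysis.FunctionSpaces

namespace RiemannSphere

/-! ### The Cauchy transform of `C^{k,r}_b` densities supported in the disc `‖z‖ < 2` -/

section Cauchy

variable {F : Type} [NormedAddCommGroup F] [NormedSpace ℂ F] {k : ℕ} {r : ℝ≥0}

/-- A member of `C^{k,r}_b` vanishing for `‖z‖ ≥ 2` has compact support. [folklore] -/
theorem hasCompactSupport_of_eq_zero_of_two_le (g : ContDiffHolderFunction ℂ F k r)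
    (hg : ∀ z : ℂ, 2 ≤ ‖z‖ → g z = 0) : HasCompactSupport (g : ℂ → F) :=
  IsCompact.of_isClosed_subset (isCompact_closedBall _ _) (isClosed_tsupport _)
    (tsupport_subset_closedBall_of_eq_zero hg)

/-- **The Cauchy transform package on the disc** (`0 < r < 1`, `F` finite dimensional): for
`g ∈ C^{k,r}_b(ℂ, F)` vanishing for `‖z‖ ≥ 2`, `T g ∈ C^{k+1,r}_b`, `∂̄ (T g) = g` on `ℂ`, and
`T g → 0` at infinity (`cauchyTransform_contDiffHolder_succ` with the a priori estimate
`cauchyTransformHolderApriori_of_lt_one`). [folklore] -/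
theorem cauchyTransform_package [CompleteSpace F] [FiniteDimensional ℂ F] (hr0 : 0 < r)
    (hr1 : r < 1) (g : ContDiffHolderFunction ℂ F k r) (hg : ∀ z : ℂ, 2 ≤ ‖z‖ → g z = 0) :
    MemContDiffHolder (k + 1) r (cauchyTransformAlong (1 : ℂ) (g : ℂ → F)) ∧
      (∀ z, dbarAlong (1 : ℂ) (cauchyTransformAlong (1 : ℂ) (g : ℂ → F)) z = g z) ∧
      Tendsto (cauchyTransformAlong (1 : ℂ) (g : ℂ → F)) (cocompact ℂ) (𝓝 0) := by
  obtain ⟨C, -, hC⟩ := cauchyTransform_contDiffHolder_succ F hr0 hr1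
    (cauchyTransformHolderApriori_of_lt_one F hr0 hr1) k 2 two_pos
  obtain ⟨h1, -, h3, h4⟩ := hC g hg
  exact ⟨h1, h3, h4⟩

/-- **The Cauchy transform of a density supported in `‖z‖ < 2` is holomorphic for `‖z‖ > 2`.**
[cite: HormanderSCV1973, Thm. 1.2.2] -/
theorem differentiableAt_cauchyTransform_of_two_lt [CompleteSpace F]
    (g : ContDiffHolderFunction ℂ F k r) (hg : ∀ z : ℂ, 2 ≤ ‖z‖ → g z = 0) {z : ℂ}
    (hz : 2 < ‖z‖) :
    DifferentiableAt ℂ (cauchyTransformAlong (1 : ℂ) (g : ℂ → F)) z := by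
  have hρ : (‖z‖ - 2) / 2 < ‖z‖ - 2 := by linarith
  have hzero : ∀ y ∈ ball z (‖z‖ - 2), g y = 0 := fun y hy => by
    refine hg y ?_
    rw [mem_ball, dist_eq_norm] at hy
    have := norm_sub_norm_le z y
    have h' : ‖z - y‖ = ‖y - z‖ := norm_sub_rev z y
    linarith
  have hd := SimilarityVector.differentiableOn_cauchyTransform_of_eq_zero g.continuous
    (hasCompactSupport_of_eq_zero_of_two_le g hg) hρ hzero
  exact hd.differentiableAt (isOpen_ball.mem_nhds (mem_ball_self (by linarith)))

/-- The Cauchy transform is additive on members of `C^{k,r}_b` with compact support. [folklore] -/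
theorem cauchyTransform_coe_add (g g' : ContDiffHolderFunction ℂ F k r)
    (hg : HasCompactSupport (g : ℂ → F)) (hg' : HasCompactSupport (g' : ℂ → F)) (z : ℂ) :
    cauchyTransformAlong (1 : ℂ) ((g + g' : ContDiffHolderFunction ℂ F k r) : ℂ → F) z =
      cauchyTransformAlong (1 : ℂ) (g : ℂ → F) z + cauchyTransformAlong (1 : ℂ) (g' : ℂ → F) z := by
  rw [ContDiffHolderFunction.coe_add]
  exact cauchyTransformAlong_add g.continuous hg g'.continuous hg' one_ne_zero z

/-- The Cauchy transform commutes with real scalars on members of `C^{k,r}_b`. [folklore] -/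
theorem cauchyTransform_coe_smul (a : ℝ) (g : ContDiffHolderFunction ℂ F k r) (z : ℂ) :
    cauchyTransformAlong (1 : ℂ) ((a • g : ContDiffHolderFunction ℂ F k r) : ℂ → F) z =
      a • cauchyTransformAlong (1 : ℂ) (g : ℂ → F) z := by
  rw [ContDiffHolderFunction.coe_smul]
  have h : (a • (g : ℂ → F)) = ((a : ℂ) • (g : ℂ → F)) := by
    funext x
    simp [Complex.coe_smul]
  rw [h, cauchyTransformAlong_const_smul, Complex.coe_smul]

/-- **Continuity of the point evaluations of `g ↦ T (χ • g)`** on `C^{k,r}_b(ℂ, F)`, for a smooth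
cutoff `χ` with `|χ| ≤ 1` supported in `‖z‖ < 2`: `‖T (χ g)(z)‖ ≤ 12 ‖g‖`
(`norm_cauchyTransform_le_uniform`). [folklore] -/
theorem continuous_cauchyTransform_coeff_apply (hr : r ≤ 1) {χ : ℂ → ℝ} (hχ : ContDiff ℝ ∞ χ)
    (hχs : HasCompactSupport χ) (hχ1 : ∀ z, |χ z| ≤ 1) (hχ2 : ∀ z, χ z ≠ 0 → ‖z‖ < 2) (z : ℂ) :
    Continuous fun g : ContDiffHolderFunction ℂ F k r =>
      cauchyTransformAlong (1 : ℂ)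
        ((ContDiffHolderFunction.coeffCLM hr χ hχ hχs g : ContDiffHolderFunction ℂ F k r) : ℂ → F)
        z := by
  have hcs : ∀ g : ContDiffHolderFunction ℂ F k r, HasCompactSupport
      ((ContDiffHolderFunction.coeffCLM hr χ hχ hχs g : ContDiffHolderFunction ℂ F k r) :
        ℂ → F) := fun g => by
    change HasCompactSupport fun x => χ x • g x
    exact hχs.smul_right
  set L : ContDiffHolderFunction ℂ F k r →ₗ[ℝ] F :=
    { toFun := fun g => cauchyTransformAlong (1 : ℂ)
        ((ContDiffHolderFunction.coeffCLM hr χ hχ hχs g : ContDiffHolderFunction ℂ F k r) :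
          ℂ → F) z
      map_add' := fun g g' => by
        simp only [map_add]
        exact cauchyTransform_coe_add _ _ (hcs g) (hcs g') z
      map_smul' := fun a g => by
        simp only [map_smul, RingHom.id_apply]
        exact cauchyTransform_coe_smul a _ z } with hL
  have hbound : ∀ g, ‖L g‖ ≤ 6 * 2 * ‖g‖ := fun g => by
    refine norm_cauchyTransform_le_uniform (by norm_num) (norm_nonneg g) (fun x hx => ?_)
      (fun x => ?_) z
    · refine hχ2 x fun h => hx ?_
      change χ x • g x = 0
      rw [h, zero_smul]
    · change ‖χ x • g x‖ ≤ ‖g‖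
      rw [norm_smul, Real.norm_eq_abs]
      calc |χ x| * ‖g x‖ ≤ 1 * ‖g x‖ := by gcongr; exact hχ1 x
        _ = ‖g x‖ := one_mul _
        _ ≤ ‖g‖ := g.norm_apply_le_norm x
  exact AddMonoidHomClass.continuous_of_bound L (6 * 2) hbound

end Cauchy

/-! ### The right inverse -/

section RightInverse

variable {F : Type} [NormedAddCommGroup F] [NormedSpace ℂ F] [CompleteSpace F]
  [FiniteDimensional ℂ F] {k : ℕ} {r : ℝ≥0}

omit [CompleteSpace F] [FiniteDimensional ℂ F] in
/-- `τ' w = -ε wⁿ (w̄)⁻²` is zero-free off the origin (`ε ≠ 0`). [folklore] -/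
theorem dbarMonomialClutch_ne_zero {ε : ℂ} (hε : ε ≠ 0) (n : ℕ) (w : ℂ) (hw : w ≠ 0) :
    (fun w : ℂ => -(ε * w ^ n * ((starRingEnd ℂ) w)⁻¹ ^ 2)) w ≠ 0 := by
  refine neg_ne_zero.2 (mul_ne_zero (mul_ne_zero hε (pow_ne_zero n hw)) (pow_ne_zero 2 ?_))
  exact inv_ne_zero ((map_ne_zero _).2 hw)

/-- **The `z`-chart density** `χ • g₀` of a pair of pieces `(g₀, g₁)`, a member of `C^{k,r}_b`
vanishing for `‖z‖ ≥ 2`. [folklore] -/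
def densA (hr : r ≤ 1) (η : ContDiffHolderFunction ℂ F k r × ContDiffHolderFunction ℂ F k r) :
    ContDiffHolderFunction ℂ F k r :=
  ContDiffHolderFunction.coeffCLM hr chiCut contDiff_chiCut hasCompactSupport_chiCut η.1

/-- **The `w`-chart density** `χ' • g₁` of a pair of pieces `(g₀, g₁)`, a member of `C^{k,r}_b`
vanishing for `‖w‖ ≥ 1`. [folklore] -/
def densB (hr : r ≤ 1) (η : ContDiffHolderFunction ℂ F k r × ContDiffHolderFunction ℂ F k r) :
    ContDiffHolderFunction ℂ F k r :=
  ContDiffHolderFunction.coeffCLM hr chiCut' contDiff_chiCut' hasCompactSupport_chiCut' η.2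

omit [CompleteSpace F] [FiniteDimensional ℂ F] in
/-- Pointwise: `densA hr η z = χ z • η.1 z`. [folklore] -/
@[simp] theorem densA_apply (hr : r ≤ 1)
    (η : ContDiffHolderFunction ℂ F k r × ContDiffHolderFunction ℂ F k r) (z : ℂ) :
    densA hr η z = chiCut z • η.1 z := rfl

omit [CompleteSpace F] [FiniteDimensional ℂ F] in
/-- Pointwise: `densB hr η w = χ' w • η.2 w`. [folklore] -/
@[simp] theorem densB_apply (hr : r ≤ 1)
    (η : ContDiffHolderFunction ℂ F k r × ContDiffHolderFunction ℂ F k r) (w : ℂ) :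
    densB hr η w = chiCut' w • η.2 w := rfl

omit [CompleteSpace F] [FiniteDimensional ℂ F] in
/-- `densA hr η` vanishes for `‖z‖ ≥ 2`. [folklore] -/
theorem densA_eq_zero (hr : r ≤ 1)
    (η : ContDiffHolderFunction ℂ F k r × ContDiffHolderFunction ℂ F k r) (z : ℂ) (hz : 2 ≤ ‖z‖) :
    densA hr η z = 0 := by
  rw [densA_apply, chiCut_eq_zero_of_two_le hz, zero_smul]

omit [CompleteSpace F] [FiniteDimensional ℂ F] in
/-- `densB hr η` vanishes for `‖w‖ ≥ 2` (indeed for `‖w‖ ≥ 1`). [folklore] -/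
theorem densB_eq_zero (hr : r ≤ 1)
    (η : ContDiffHolderFunction ℂ F k r × ContDiffHolderFunction ℂ F k r) (w : ℂ) (hw : 2 ≤ ‖w‖) :
    densB hr η w = 0 := by
  rw [densB_apply, chiCut'_eq_zero (le_trans (by norm_num) hw), zero_smul]

/-- **The `z`-chart representative of `R η`**: `T (χ g₀) + transplant_{ε⁻¹ zⁿ} (T (χ' g₁))`.
[cite: Wendl2018, §2.1.3] -/
def rep₀ (ε : ℂ) (n : ℕ) (hr : r ≤ 1)
    (η : ContDiffHolderFunction ℂ F k r × ContDiffHolderFunction ℂ F k r) (z : ℂ) : F :=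
  cauchyTransformAlong (1 : ℂ) (densA hr η : ℂ → F) z +
    transplant (fun w : ℂ => ε⁻¹ * w ^ n) (cauchyTransformAlong (1 : ℂ) (densB hr η : ℂ → F)) z

/-- **The `w`-chart representative of `R η`**: `transplant_{ε wⁿ} (T (χ g₀)) + T (χ' g₁)`.
[cite: Wendl2018, §2.1.3] -/
def rep₁ (ε : ℂ) (n : ℕ) (hr : r ≤ 1)
    (η : ContDiffHolderFunction ℂ F k r × ContDiffHolderFunction ℂ F k r) (w : ℂ) : F :=
  transplant (fun w : ℂ => ε * w ^ n) (cauchyTransformAlong (1 : ℂ) (densA hr η : ℂ → F)) w +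
    cauchyTransformAlong (1 : ℂ) (densB hr η : ℂ → F) w

omit [CompleteSpace F] [FiniteDimensional ℂ F] in
/-- **The representatives are clutched**: `rep₁ w = ε wⁿ • rep₀ w⁻¹` for `w ≠ 0`. [folklore] -/
theorem rep₁_eq_smul_rep₀ {ε : ℂ} (hε : ε ≠ 0) (n : ℕ) (hr : r ≤ 1)
    (η : ContDiffHolderFunction ℂ F k r × ContDiffHolderFunction ℂ F k r) {w : ℂ} (hw : w ≠ 0) :
    rep₁ ε n hr η w = (ε * w ^ n) • rep₀ ε n hr η w⁻¹ := by
  simp only [rep₀, rep₁, transplant_of_ne_zero _ _ hw, transplant_of_ne_zero _ _ (inv_ne_zero hw),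
    inv_inv, smul_add, smul_smul]
  congr 1
  rw [inv_pow, show ε * w ^ n * (ε⁻¹ * (w ^ n)⁻¹) = 1 by field_simp, one_smul]

/-- `τ w = ε wⁿ` is entire. [folklore] -/
theorem differentiable_monomialClutch (ε : ℂ) (n : ℕ) :
    Differentiable ℂ (fun w : ℂ => ε * w ^ n) :=
  (differentiable_id.pow n).const_mul ε

/-- `τ w = ε wⁿ` is real-smooth. [folklore] -/
theorem contDiff_monomialClutch (ε : ℂ) (n : ℕ) :
    ContDiff ℝ ∞ (fun w : ℂ => ε * w ^ n) :=
  ((contDiff_const.mul (contDiff_id.pow n) :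
    ContDiff ℂ ∞ (fun w : ℂ => ε * w ^ n))).restrict_scalars ℝ

/-- **The first piece `ρ • rep₀` is in `C^{k+1,r}_b`.** [folklore] -/
theorem memContDiffHolder_rhoCut_smul_rep₀ (ε : ℂ) (n : ℕ) (hr0 : 0 < r) (hr1 : r < 1)
    (η : ContDiffHolderFunction ℂ F k r × ContDiffHolderFunction ℂ F k r) :
    MemContDiffHolder (k + 1) r fun z => (rhoCut z : ℂ) • rep₀ ε n hr1.le η z := by
  obtain ⟨hmA, -, -⟩ := cauchyTransform_package hr0 hr1 (densA hr1.le η) (densA_eq_zero hr1.le η)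
  obtain ⟨hmB, -, hdB⟩ := cauchyTransform_package hr0 hr1 (densB hr1.le η) (densB_eq_zero hr1.le η)
  have h1 := hmA.ofReal_smul hr1.le contDiff_rhoCut hasCompactSupport_rhoCut
  have h2 := memContDiffHolder_rhoCut_smul_transplant hr1.le
    (differentiable_monomialClutch ε⁻¹ n) (contDiff_monomialClutch ε⁻¹ n) hmB
    (fun z hz => differentiableAt_cauchyTransform_of_two_lt _ (densB_eq_zero hr1.le η) hz) hdB
  have h := h1.add h2
  simpa only [rep₀, smul_add, Pi.add_def] using h

/-- **The second piece `ρ • rep₁` is in `C^{k+1,r}_b`.** [folklore] -/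
theorem memContDiffHolder_rhoCut_smul_rep₁ (ε : ℂ) (n : ℕ) (hr0 : 0 < r) (hr1 : r < 1)
    (η : ContDiffHolderFunction ℂ F k r × ContDiffHolderFunction ℂ F k r) :
    MemContDiffHolder (k + 1) r fun w => (rhoCut w : ℂ) • rep₁ ε n hr1.le η w := by
  obtain ⟨hmA, -, hdA⟩ := cauchyTransform_package hr0 hr1 (densA hr1.le η) (densA_eq_zero hr1.le η)
  obtain ⟨hmB, -, -⟩ := cauchyTransform_package hr0 hr1 (densB hr1.le η) (densB_eq_zero hr1.le η)
  have h1 := memContDiffHolder_rhoCut_smul_transplant hr1.le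
    (differentiable_monomialClutch ε n) (contDiff_monomialClutch ε n) hmA
    (fun z hz => differentiableAt_cauchyTransform_of_two_lt _ (densA_eq_zero hr1.le η) hz) hdA
  have h2 := hmB.ofReal_smul hr1.le contDiff_rhoCut hasCompactSupport_rhoCut
  have h := h1.add h2
  simpa only [rep₁, smul_add, Pi.add_def] using h

/-- The first piece `ρ • rep₀ η` as a member of `C^{k+1,r}_b`. [folklore] -/
def piece₀ (ε : ℂ) (n : ℕ) (hr0 : 0 < r) (hr1 : r < 1)
    (η : ContDiffHolderFunction ℂ F k r × ContDiffHolderFunction ℂ F k r) :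
    ContDiffHolderFunction ℂ F (k + 1) r :=
  ⟨fun z => (rhoCut z : ℂ) • rep₀ ε n hr1.le η z, memContDiffHolder_rhoCut_smul_rep₀ ε n hr0 hr1 η⟩

/-- The second piece `ρ • rep₁ η` as a member of `C^{k+1,r}_b`. [folklore] -/
def piece₁ (ε : ℂ) (n : ℕ) (hr0 : 0 < r) (hr1 : r < 1)
    (η : ContDiffHolderFunction ℂ F k r × ContDiffHolderFunction ℂ F k r) :
    ContDiffHolderFunction ℂ F (k + 1) r :=
  ⟨fun w => (rhoCut w : ℂ) • rep₁ ε n hr1.le η w, memContDiffHolder_rhoCut_smul_rep₁ ε n hr0 hr1 η⟩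

/-- Pointwise formula for the first piece. [folklore] -/
@[simp] theorem piece₀_apply (ε : ℂ) (n : ℕ) (hr0 : 0 < r) (hr1 : r < 1)
    (η : ContDiffHolderFunction ℂ F k r × ContDiffHolderFunction ℂ F k r) (z : ℂ) :
    piece₀ ε n hr0 hr1 η z = (rhoCut z : ℂ) • rep₀ ε n hr1.le η z := rfl

/-- Pointwise formula for the second piece. [folklore] -/
@[simp] theorem piece₁_apply (ε : ℂ) (n : ℕ) (hr0 : 0 < r) (hr1 : r < 1)
    (η : ContDiffHolderFunction ℂ F k r × ContDiffHolderFunction ℂ F k r) (w : ℂ) :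
    piece₁ ε n hr0 hr1 η w = (rhoCut w : ℂ) • rep₁ ε n hr1.le η w := rfl

omit [CompleteSpace F] [FiniteDimensional ℂ F] in
/-- `densA`, `densB` have compact support. [folklore] -/
theorem hasCompactSupport_densA_densB (hr : r ≤ 1)
    (η : ContDiffHolderFunction ℂ F k r × ContDiffHolderFunction ℂ F k r) :
    HasCompactSupport (densA hr η : ℂ → F) ∧ HasCompactSupport (densB hr η : ℂ → F) :=
  ⟨hasCompactSupport_of_eq_zero_of_two_le _ (densA_eq_zero hr η),
    hasCompactSupport_of_eq_zero_of_two_le _ (densB_eq_zero hr η)⟩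

omit [CompleteSpace F] [FiniteDimensional ℂ F] in
/-- `η ↦ T (densA η)` is additive. [folklore] -/
theorem cauchyTransform_densA_add (hr : r ≤ 1)
    (η η' : ContDiffHolderFunction ℂ F k r × ContDiffHolderFunction ℂ F k r) :
    cauchyTransformAlong (1 : ℂ) (densA hr (η + η') : ℂ → F) =
      cauchyTransformAlong (1 : ℂ) (densA hr η : ℂ → F) +
        cauchyTransformAlong (1 : ℂ) (densA hr η' : ℂ → F) := by
  funext z
  rw [show densA hr (η + η') = densA hr η + densA hr η' by simp [densA]]
  exact cauchyTransform_coe_add _ _ (hasCompactSupport_densA_densB hr η).1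
    (hasCompactSupport_densA_densB hr η').1 z

omit [CompleteSpace F] [FiniteDimensional ℂ F] in
/-- `η ↦ T (densB η)` is additive. [folklore] -/
theorem cauchyTransform_densB_add (hr : r ≤ 1)
    (η η' : ContDiffHolderFunction ℂ F k r × ContDiffHolderFunction ℂ F k r) :
    cauchyTransformAlong (1 : ℂ) (densB hr (η + η') : ℂ → F) =
      cauchyTransformAlong (1 : ℂ) (densB hr η : ℂ → F) +
        cauchyTransformAlong (1 : ℂ) (densB hr η' : ℂ → F) := by
  funext z
  rw [show densB hr (η + η') = densB hr η + densB hr η' by simp [densB]]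
  exact cauchyTransform_coe_add _ _ (hasCompactSupport_densA_densB hr η).2
    (hasCompactSupport_densA_densB hr η').2 z

omit [CompleteSpace F] [FiniteDimensional ℂ F] in
/-- `η ↦ T (densA η)` commutes with real scalars. [folklore] -/
theorem cauchyTransform_densA_smul (hr : r ≤ 1) (a : ℝ)
    (η : ContDiffHolderFunction ℂ F k r × ContDiffHolderFunction ℂ F k r) :
    cauchyTransformAlong (1 : ℂ) (densA hr (a • η) : ℂ → F) =
      a • cauchyTransformAlong (1 : ℂ) (densA hr η : ℂ → F) := by
  funext z
  rw [show densA hr (a • η) = a • densA hr η by simp [densA]]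
  exact cauchyTransform_coe_smul a _ z

omit [CompleteSpace F] [FiniteDimensional ℂ F] in
/-- `η ↦ T (densB η)` commutes with real scalars. [folklore] -/
theorem cauchyTransform_densB_smul (hr : r ≤ 1) (a : ℝ)
    (η : ContDiffHolderFunction ℂ F k r × ContDiffHolderFunction ℂ F k r) :
    cauchyTransformAlong (1 : ℂ) (densB hr (a • η) : ℂ → F) =
      a • cauchyTransformAlong (1 : ℂ) (densB hr η : ℂ → F) := by
  funext z
  rw [show densB hr (a • η) = a • densB hr η by simp [densB]]
  exact cauchyTransform_coe_smul a _ z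

omit [CompleteSpace F] [FiniteDimensional ℂ F] in
/-- `rep₀` is additive in `η`. [folklore] -/
theorem rep₀_add (ε : ℂ) (n : ℕ) (hr : r ≤ 1)
    (η η' : ContDiffHolderFunction ℂ F k r × ContDiffHolderFunction ℂ F k r) :
    rep₀ ε n hr (η + η') = rep₀ ε n hr η + rep₀ ε n hr η' := by
  funext z
  simp only [rep₀, Pi.add_apply, cauchyTransform_densA_add, cauchyTransform_densB_add,
    transplant_add]
  abel

omit [CompleteSpace F] [FiniteDimensional ℂ F] in
/-- `rep₁` is additive in `η`. [folklore] -/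
theorem rep₁_add (ε : ℂ) (n : ℕ) (hr : r ≤ 1)
    (η η' : ContDiffHolderFunction ℂ F k r × ContDiffHolderFunction ℂ F k r) :
    rep₁ ε n hr (η + η') = rep₁ ε n hr η + rep₁ ε n hr η' := by
  funext w
  simp only [rep₁, Pi.add_apply, cauchyTransform_densA_add, cauchyTransform_densB_add,
    transplant_add]
  abel

omit [CompleteSpace F] [FiniteDimensional ℂ F] in
/-- `rep₀` commutes with real scalars in `η`. [folklore] -/
theorem rep₀_smul (ε : ℂ) (n : ℕ) (hr : r ≤ 1) (a : ℝ)
    (η : ContDiffHolderFunction ℂ F k r × ContDiffHolderFunction ℂ F k r) :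
    rep₀ ε n hr (a • η) = a • rep₀ ε n hr η := by
  funext z
  simp only [rep₀, Pi.smul_apply, cauchyTransform_densA_smul, cauchyTransform_densB_smul,
    transplant_smul, smul_add]

omit [CompleteSpace F] [FiniteDimensional ℂ F] in
/-- `rep₁` commutes with real scalars in `η`. [folklore] -/
theorem rep₁_smul (ε : ℂ) (n : ℕ) (hr : r ≤ 1) (a : ℝ)
    (η : ContDiffHolderFunction ℂ F k r × ContDiffHolderFunction ℂ F k r) :
    rep₁ ε n hr (a • η) = a • rep₁ ε n hr η := by
  funext w
  simp only [rep₁, Pi.smul_apply, cauchyTransform_densA_smul, cauchyTransform_densB_smul,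
    transplant_smul, smul_add]

/-- The first piece as a linear map `C^{k,r}_b × C^{k,r}_b →ₗ C^{k+1,r}_b`. [folklore] -/
def piece₀ₗ (ε : ℂ) (n : ℕ) (hr0 : 0 < r) (hr1 : r < 1) :
    (ContDiffHolderFunction ℂ F k r × ContDiffHolderFunction ℂ F k r) →ₗ[ℝ]
      ContDiffHolderFunction ℂ F (k + 1) r where
  toFun := piece₀ ε n hr0 hr1
  map_add' η η' := ContDiffHolderFunction.ext fun z => by
    simp [rep₀_add, smul_add]
  map_smul' a η := ContDiffHolderFunction.ext fun z => by
    simp [rep₀_smul, smul_comm a]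

/-- The second piece as a linear map `C^{k,r}_b × C^{k,r}_b →ₗ C^{k+1,r}_b`. [folklore] -/
def piece₁ₗ (ε : ℂ) (n : ℕ) (hr0 : 0 < r) (hr1 : r < 1) :
    (ContDiffHolderFunction ℂ F k r × ContDiffHolderFunction ℂ F k r) →ₗ[ℝ]
      ContDiffHolderFunction ℂ F (k + 1) r where
  toFun := piece₁ ε n hr0 hr1
  map_add' η η' := ContDiffHolderFunction.ext fun w => by
    simp [rep₁_add, smul_add]
  map_smul' a η := ContDiffHolderFunction.ext fun w => by
    simp [rep₁_smul, smul_comm a]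

omit [CompleteSpace F] [FiniteDimensional ℂ F] in
/-- Continuity of `η ↦ T (densA η) z` and `η ↦ T (densB η) z`. [folklore] -/
theorem continuous_cauchyTransform_densA_densB (hr : r ≤ 1) (z : ℂ) :
    (Continuous fun η : ContDiffHolderFunction ℂ F k r × ContDiffHolderFunction ℂ F k r =>
      cauchyTransformAlong (1 : ℂ) (densA hr η : ℂ → F) z) ∧
    Continuous fun η : ContDiffHolderFunction ℂ F k r × ContDiffHolderFunction ℂ F k r =>
      cauchyTransformAlong (1 : ℂ) (densB hr η : ℂ → F) z :=
  ⟨(continuous_cauchyTransform_coeff_apply hr contDiff_chiCut hasCompactSupport_chiCut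
      abs_chiCut_le_one (fun _ h => norm_lt_two_of_chiCut_ne_zero h) z).comp continuous_fst,
    (continuous_cauchyTransform_coeff_apply hr contDiff_chiCut' hasCompactSupport_chiCut'
      abs_chiCut'_le_one (fun _ h => (norm_lt_one_of_chiCut'_ne_zero h).trans one_lt_two) z).comp
      continuous_snd⟩

omit [CompleteSpace F] [FiniteDimensional ℂ F] in
/-- Continuity of the point evaluations of a transplanted Cauchy transform. [folklore] -/
theorem continuous_transplant_apply {X : Type*} [TopologicalSpace X] (c : ℂ → ℂ)
    {u : X → ℂ → F} (hu : ∀ z, Continuous fun x => u x z) (z : ℂ) :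
    Continuous fun x => transplant c (u x) z := by
  by_cases hz : z = 0
  · subst hz
    simp only [transplant_zero]
    exact continuous_const
  · simp only [transplant_of_ne_zero _ _ hz]
    exact (hu _).const_smul _

/-- **The right inverse on pairs of pieces**, a bounded operator
`C^{k,r}_b × C^{k,r}_b →L C^{k+1,r}_b × C^{k+1,r}_b` (continuity by the closed graph theorem:
the point evaluations are continuous since `T` is bounded from sup-norm data on a fixed disc to
pointwise values). [cite: Wendl2018, §2.1.3] -/
def rightInvCLM (ε : ℂ) (n : ℕ) (hr0 : 0 < r) (hr1 : r < 1) :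
    (ContDiffHolderFunction ℂ F k r × ContDiffHolderFunction ℂ F k r) →L[ℝ]
      (ContDiffHolderFunction ℂ F (k + 1) r × ContDiffHolderFunction ℂ F (k + 1) r) :=
  (ContDiffHolderFunction.clmOfContinuousEval (piece₀ₗ ε n hr0 hr1) fun z => by
      change Continuous fun η => (rhoCut z : ℂ) • rep₀ ε n hr1.le η z
      refine Continuous.const_smul ?_ _
      exact (continuous_cauchyTransform_densA_densB hr1.le z).1.add
        (continuous_transplant_apply _
          (fun y => (continuous_cauchyTransform_densA_densB hr1.le y).2) z)).prod
    (ContDiffHolderFunction.clmOfContinuousEval (piece₁ₗ ε n hr0 hr1) fun w => by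
      change Continuous fun η => (rhoCut w : ℂ) • rep₁ ε n hr1.le η w
      refine Continuous.const_smul ?_ _
      exact (continuous_transplant_apply _
          (fun y => (continuous_cauchyTransform_densA_densB hr1.le y).1) w).add
        (continuous_cauchyTransform_densA_densB hr1.le w).2)

/-- `rightInvCLM` returns the pair of pieces `(ρ • rep₀ η, ρ • rep₁ η)`. [folklore] -/
theorem rightInvCLM_apply (ε : ℂ) (n : ℕ) (hr0 : 0 < r) (hr1 : r < 1)
    (η : ContDiffHolderFunction ℂ F k r × ContDiffHolderFunction ℂ F k r) :
    rightInvCLM ε n hr0 hr1 η = (piece₀ ε n hr0 hr1 η, piece₁ ε n hr0 hr1 η) := rfl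

/-- The image of `rightInvCLM` consists of members of `𝓗^{k+1,r}_{ε wⁿ}` (the representatives
`rep₀`, `rep₁` are clutched by construction). [folklore] -/
theorem rightInvCLM_mem {ε : ℂ} (hε : ε ≠ 0) (n : ℕ) (hr0 : 0 < r) (hr1 : r < 1)
    (η : ContDiffHolderFunction ℂ F k r × ContDiffHolderFunction ℂ F k r) :
    rightInvCLM ε n hr0 hr1 η ∈ holderSections F (fun w : ℂ => ε * w ^ n) (k + 1) r :=
  (mem_holderSections_iff (monomialClutch_ne_zero hε n)).2 ⟨rep₀ ε n hr1.le η, rep₁ ε n hr1.le η,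
    fun _ hw => rep₁_eq_smul_rep₀ hε n hr1.le η hw, fun _ => rfl, fun _ => rfl⟩

/-- **The bounded right inverse `R` of `∂̄ : 𝓗^{k+1,r}_{O(n)} → 𝓗^{k,r}_{O(n) ⊗ Λ^{0,1}}`** on
the Riemann sphere (`0 < r < 1`, `F` finite dimensional), built from Cauchy transforms in the
two charts: `R η = (ρ • rep₀ η, ρ • rep₁ η)`. [cite: Wendl2018, §2.1.3] -/
def dbarRightInv (ε : ℂ) (hε : ε ≠ 0) (n k : ℕ) (hr0 : 0 < r) (hr1 : r < 1) :
    holderSections F (fun w : ℂ => -(ε * w ^ n * ((starRingEnd ℂ) w)⁻¹ ^ 2)) k r →L[ℝ]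
      holderSections F (fun w : ℂ => ε * w ^ n) (k + 1) r :=
  ((rightInvCLM ε n hr0 hr1).comp
    (holderSections F (fun w : ℂ => -(ε * w ^ n * ((starRingEnd ℂ) w)⁻¹ ^ 2)) k
      r).subtypeL).codRestrict (holderSections F (fun w : ℂ => ε * w ^ n) (k + 1) r) fun η =>
      rightInvCLM_mem hε n hr0 hr1
        (η : ContDiffHolderFunction ℂ F k r × ContDiffHolderFunction ℂ F k r)

/-- The underlying pair of pieces of `dbarRightInv … η`. [folklore] -/
theorem coe_dbarRightInv_apply (ε : ℂ) (hε : ε ≠ 0) (n k : ℕ) (hr0 : 0 < r) (hr1 : r < 1)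
    (η : holderSections F (fun w : ℂ => -(ε * w ^ n * ((starRingEnd ℂ) w)⁻¹ ^ 2)) k r) :
    (dbarRightInv ε hε n k hr0 hr1 η : ContDiffHolderFunction ℂ F (k + 1) r ×
      ContDiffHolderFunction ℂ F (k + 1) r) =
      (piece₀ ε n hr0 hr1 (η : ContDiffHolderFunction ℂ F k r × ContDiffHolderFunction ℂ F k r),
        piece₁ ε n hr0 hr1 (η : ContDiffHolderFunction ℂ F k r × ContDiffHolderFunction ℂ F k r)) :=
  rfl

/-! ### Reading back the representatives -/

/-- The `z`-representative of `R η` is `rep₀ η` (`sec₀_eq_of_pieces` of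
`Literature/Analysis/Complex/RiemannSphereSectionOperators.lean`). [folklore] -/
theorem sec₀_dbarRightInv (ε : ℂ) (hε : ε ≠ 0) (n k : ℕ) (hr0 : 0 < r) (hr1 : r < 1)
    (η : holderSections F (fun w : ℂ => -(ε * w ^ n * ((starRingEnd ℂ) w)⁻¹ ^ 2)) k r) :
    sec₀ (fun w : ℂ => ε * w ^ n) (dbarRightInv ε hε n k hr0 hr1 η :
      ContDiffHolderFunction ℂ F (k + 1) r × ContDiffHolderFunction ℂ F (k + 1) r) =
      rep₀ ε n hr1.le (η : ContDiffHolderFunction ℂ F k r × ContDiffHolderFunction ℂ F k r) :=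
  funext fun z => sec₀_eq_of_pieces (monomialClutch_ne_zero hε n)
    (fun _ hw => rep₁_eq_smul_rep₀ hε n hr1.le _ hw) (fun _ => rfl) (fun _ => rfl) z

/-- The `w`-representative of `R η` is `rep₁ η`. [folklore] -/
theorem sec₁_dbarRightInv (ε : ℂ) (hε : ε ≠ 0) (n k : ℕ) (hr0 : 0 < r) (hr1 : r < 1)
    (η : holderSections F (fun w : ℂ => -(ε * w ^ n * ((starRingEnd ℂ) w)⁻¹ ^ 2)) k r) :
    sec₁ (fun w : ℂ => ε * w ^ n) (dbarRightInv ε hε n k hr0 hr1 η :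
      ContDiffHolderFunction ℂ F (k + 1) r × ContDiffHolderFunction ℂ F (k + 1) r) =
      rep₁ ε n hr1.le (η : ContDiffHolderFunction ℂ F k r × ContDiffHolderFunction ℂ F k r) :=
  funext fun w => sec₁_eq_of_pieces (monomialClutch_ne_zero hε n)
    (fun _ hw => rep₁_eq_smul_rep₀ hε n hr1.le _ hw) (fun _ => rfl) (fun _ => rfl) w

/-! ### `∂̄ R = id`, chart by chart -/

/-- **`∂̄ rep₀ η = sec₀ τ' η`** for a member `η ∈ 𝓗^{k,r}_{τ'}`: `∂̄ T (χ g₀) = χ g₀`, the chain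
rule
under inversion for the transplanted piece (`∂̄ (f ∘ (·)⁻¹)(z) = -(z̄)⁻² (∂̄ f)(z⁻¹)`, the
coefficient `ε⁻¹ zⁿ` being holomorphic), the clutching relation of `η`, and the partition
identity `χ ρ + (1 - χ) ρ ∘ (·)⁻¹ = 1`; at `z = 0` the transplanted piece is holomorphic
(removable singularity) and `χ 0 = 1`. [cite: Wendl2018, §2.1.3] -/
theorem dbarAlong_rep₀ {ε : ℂ} (hε : ε ≠ 0) (n : ℕ) (hr0 : 0 < r) (hr1 : r < 1)
    {η : ContDiffHolderFunction ℂ F k r × ContDiffHolderFunction ℂ F k r}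
    (hη : η ∈ holderSections F (fun w : ℂ => -(ε * w ^ n * ((starRingEnd ℂ) w)⁻¹ ^ 2)) k r)
    (z : ℂ) :
    dbarAlong 1 (rep₀ ε n hr1.le η) z =
      sec₀ (fun w : ℂ => -(ε * w ^ n * ((starRingEnd ℂ) w)⁻¹ ^ 2)) η z := by
  obtain ⟨hmA, hdA, -⟩ :=
    cauchyTransform_package hr0 hr1 (densA hr1.le η) (densA_eq_zero hr1.le η)
  obtain ⟨hmB, hdB, hdecB⟩ :=
    cauchyTransform_package hr0 hr1 (densB hr1.le η) (densB_eq_zero hr1.le η)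
  set uA := cauchyTransformAlong (1 : ℂ) (densA hr1.le η : ℂ → F) with huA
  set uB := cauchyTransformAlong (1 : ℂ) (densB hr1.le η : ℂ → F) with huB
  have hdiffA : Differentiable ℝ uA :=
    hmA.contDiff.differentiable (by exact_mod_cast Nat.succ_ne_zero k)
  have hdiffB : Differentiable ℝ uB :=
    hmB.contDiff.differentiable (by exact_mod_cast Nat.succ_ne_zero k)
  have hholB : ∀ y : ℂ, 2 < ‖y‖ → DifferentiableAt ℂ uB y := fun y hy =>
    differentiableAt_cauchyTransform_of_two_lt _ (densB_eq_zero hr1.le η) hy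
  have hT : Differentiable ℝ (transplant (fun w : ℂ => ε⁻¹ * w ^ n) uB) :=
    differentiable_transplant (differentiable_monomialClutch ε⁻¹ n) hdiffB hholB hdecB
  have hτ' : ∀ w : ℂ, w ≠ 0 → (fun w : ℂ => -(ε * w ^ n * ((starRingEnd ℂ) w)⁻¹ ^ 2)) w ≠ 0 :=
    dbarMonomialClutch_ne_zero hε n
  rw [show rep₀ ε n hr1.le η = fun y => uA y + transplant (fun w : ℂ => ε⁻¹ * w ^ n) uB y from rfl,
    dbarAlong_fun_add (hdiffA z) (hT z), hdA z, densA_apply]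
  by_cases hz : z = 0
  · subst hz
    rw [dbarAlong_transplant_zero (differentiable_monomialClutch ε⁻¹ n) hholB hdecB, add_zero,
      chiCut_eq_one (by simp), one_smul, sec₀_of_norm_lt (by simp)]
  · rw [dbarAlong_transplant_of_ne_zero (differentiable_monomialClutch ε⁻¹ n) hdiffB hz, hdB,
      densB_apply, chiCut'_of_ne_zero (inv_ne_zero hz), inv_inv, fst_eq_rhoCut_smul_sec₀ hη z,
      snd_eq_rhoCut_smul_sec₁ hη z⁻¹, sec₁_eq_smul_sec₀ hη hτ' (inv_ne_zero hz), inv_inv]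
    set S := sec₀ (fun w : ℂ => -(ε * w ^ n * ((starRingEnd ℂ) w)⁻¹ ^ 2)) η z with hS
    simp only [← Complex.coe_smul, smul_smul, Complex.ofReal_sub, Complex.ofReal_one]
    rw [← add_smul]
    conv_rhs => rw [← one_smul ℂ S]
    congr 1
    have hc : (chiCut z : ℂ) * rhoCut z + (1 - chiCut z) * rhoCut z⁻¹ = 1 := by
      exact_mod_cast chiCut_mul_rhoCut_add z
    have hzc : (starRingEnd ℂ) z ≠ 0 := (map_ne_zero _).2 hz
    have key : (ε⁻¹ * z ^ n * ((starRingEnd ℂ) z)⁻¹ ^ 2) *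
        (ε * z⁻¹ ^ n * ((starRingEnd ℂ) z⁻¹)⁻¹ ^ 2) = 1 := by
      have hzn : z ^ n ≠ 0 := pow_ne_zero n hz
      rw [map_inv₀, inv_inv]
      simp only [inv_pow]
      field_simp
    linear_combination hc + ((1 - (chiCut z : ℂ)) * rhoCut z⁻¹) * key

/-- **`∂̄ rep₁ η = sec₁ τ' η`** for a member `η ∈ 𝓗^{k,r}_{τ'}` (the `w`-chart twin of
`dbarAlong_rep₀`). [cite: Wendl2018, §2.1.3] -/
theorem dbarAlong_rep₁ {ε : ℂ} (hε : ε ≠ 0) (n : ℕ) (hr0 : 0 < r) (hr1 : r < 1)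
    {η : ContDiffHolderFunction ℂ F k r × ContDiffHolderFunction ℂ F k r}
    (hη : η ∈ holderSections F (fun w : ℂ => -(ε * w ^ n * ((starRingEnd ℂ) w)⁻¹ ^ 2)) k r)
    (w : ℂ) :
    dbarAlong 1 (rep₁ ε n hr1.le η) w =
      sec₁ (fun w : ℂ => -(ε * w ^ n * ((starRingEnd ℂ) w)⁻¹ ^ 2)) η w := by
  obtain ⟨hmA, hdA, hdecA⟩ :=
    cauchyTransform_package hr0 hr1 (densA hr1.le η) (densA_eq_zero hr1.le η)
  obtain ⟨hmB, hdB, -⟩ :=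
    cauchyTransform_package hr0 hr1 (densB hr1.le η) (densB_eq_zero hr1.le η)
  set uA := cauchyTransformAlong (1 : ℂ) (densA hr1.le η : ℂ → F) with huA
  set uB := cauchyTransformAlong (1 : ℂ) (densB hr1.le η : ℂ → F) with huB
  have hdiffA : Differentiable ℝ uA :=
    hmA.contDiff.differentiable (by exact_mod_cast Nat.succ_ne_zero k)
  have hdiffB : Differentiable ℝ uB :=
    hmB.contDiff.differentiable (by exact_mod_cast Nat.succ_ne_zero k)
  have hholA : ∀ y : ℂ, 2 < ‖y‖ → DifferentiableAt ℂ uA y := fun y hy =>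
    differentiableAt_cauchyTransform_of_two_lt _ (densA_eq_zero hr1.le η) hy
  have hT : Differentiable ℝ (transplant (fun w : ℂ => ε * w ^ n) uA) :=
    differentiable_transplant (differentiable_monomialClutch ε n) hdiffA hholA hdecA
  have hτ' : ∀ w : ℂ, w ≠ 0 → (fun w : ℂ => -(ε * w ^ n * ((starRingEnd ℂ) w)⁻¹ ^ 2)) w ≠ 0 :=
    dbarMonomialClutch_ne_zero hε n
  rw [show rep₁ ε n hr1.le η = fun y => transplant (fun w : ℂ => ε * w ^ n) uA y + uB y from rfl,
    dbarAlong_fun_add (hT w) (hdiffB w), hdB w, densB_apply]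
  by_cases hw : w = 0
  · subst hw
    rw [dbarAlong_transplant_zero (differentiable_monomialClutch ε n) hholA hdecA, zero_add,
      chiCut'_zero, one_smul, sec₁_of_norm_lt (by simp)]
  · rw [dbarAlong_transplant_of_ne_zero (differentiable_monomialClutch ε n) hdiffA hw, hdA,
      densA_apply, chiCut'_of_ne_zero hw, fst_eq_rhoCut_smul_sec₀ hη w⁻¹,
      snd_eq_rhoCut_smul_sec₁ hη w,
      sec₁_eq_smul_sec₀ hη hτ' hw]
    set S := sec₀ (fun w : ℂ => -(ε * w ^ n * ((starRingEnd ℂ) w)⁻¹ ^ 2)) η w⁻¹ with hS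
    simp only [← Complex.coe_smul, smul_smul, Complex.ofReal_sub, Complex.ofReal_one]
    rw [← add_smul]
    congr 1
    have hc : (chiCut w⁻¹ : ℂ) * rhoCut w⁻¹ + (1 - chiCut w⁻¹) * rhoCut w = 1 := by
      have h := chiCut_mul_rhoCut_add w⁻¹
      rw [inv_inv] at h
      exact_mod_cast h
    linear_combination (-(ε * w ^ n * ((starRingEnd ℂ) w)⁻¹ ^ 2)) * hc

/-! ### The theorem -/

/-- **`∂̄ ∘ R = id` in the `z`-chart.** [cite: Wendl2018, §2.1.3] -/
theorem dbarAlong_sec₀_dbarRightInv (ε : ℂ) (hε : ε ≠ 0) (n k : ℕ) (hr0 : 0 < r) (hr1 : r < 1)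
    (η : holderSections F (fun w : ℂ => -(ε * w ^ n * ((starRingEnd ℂ) w)⁻¹ ^ 2)) k r) (z : ℂ) :
    dbarAlong 1 (sec₀ (fun w : ℂ => ε * w ^ n) (dbarRightInv ε hε n k hr0 hr1 η :
      ContDiffHolderFunction ℂ F (k + 1) r × ContDiffHolderFunction ℂ F (k + 1) r)) z =
      sec₀ (fun w : ℂ => -(ε * w ^ n * ((starRingEnd ℂ) w)⁻¹ ^ 2))
        (η : ContDiffHolderFunction ℂ F k r × ContDiffHolderFunction ℂ F k r) z := by
  rw [sec₀_dbarRightInv]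
  exact dbarAlong_rep₀ hε n hr0 hr1 η.2 z

/-- **`∂̄ ∘ R = id` in the `w`-chart.** [cite: Wendl2018, §2.1.3] -/
theorem dbarAlong_sec₁_dbarRightInv (ε : ℂ) (hε : ε ≠ 0) (n k : ℕ) (hr0 : 0 < r) (hr1 : r < 1)
    (η : holderSections F (fun w : ℂ => -(ε * w ^ n * ((starRingEnd ℂ) w)⁻¹ ^ 2)) k r) (w : ℂ) :
    dbarAlong 1 (sec₁ (fun w : ℂ => ε * w ^ n) (dbarRightInv ε hε n k hr0 hr1 η :
      ContDiffHolderFunction ℂ F (k + 1) r × ContDiffHolderFunction ℂ F (k + 1) r)) w =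
      sec₁ (fun w : ℂ => -(ε * w ^ n * ((starRingEnd ℂ) w)⁻¹ ^ 2))
        (η : ContDiffHolderFunction ℂ F k r × ContDiffHolderFunction ℂ F k r) w := by
  rw [sec₁_dbarRightInv]
  exact dbarAlong_rep₁ hε n hr0 hr1 η.2 w

/-- **A bounded right inverse of `∂̄` on Hölder sections of `O(n)` over the Riemann sphere**
(`H^{0,1}(ℂℙ¹, O(n)) = 0` in Hölder classes; Wendl 2018, §2.1.3 / Prop. 2.53). For `ε ≠ 0`,
`n k : ℕ` and `0 < r < 1` there is a continuous linear map
`R : 𝓗^{k,r}_{τ'}(F) → 𝓗^{k+1,r}_{τ}(F)`, `τ w = ε wⁿ`, `τ' w = -ε wⁿ (w̄)⁻²` (the clutching of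
the `(0,1)`-forms with values in `O(n)`), with `∂̄ (sec₀ τ (R η)) = sec₀ τ' η` and
`∂̄ (sec₁ τ (R η)) = sec₁ τ' η` on all of `ℂ`. [cite: Wendl2018, Prop. 2.53] -/
theorem exists_dbar_rightInverse (ε : ℂ) (hε : ε ≠ 0) (n k : ℕ) (hr0 : 0 < r) (hr1 : r < 1) :
    ∃ R : holderSections F (fun w : ℂ => -(ε * w ^ n * ((starRingEnd ℂ) w)⁻¹ ^ 2)) k r →L[ℝ]
        holderSections F (fun w : ℂ => ε * w ^ n) (k + 1) r,
      ∀ η, (∀ z : ℂ, dbarAlong 1 (sec₀ (fun w : ℂ => ε * w ^ n)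
          (R η : ContDiffHolderFunction ℂ F (k + 1) r × ContDiffHolderFunction ℂ F (k + 1) r)) z =
          sec₀ (fun w : ℂ => -(ε * w ^ n * ((starRingEnd ℂ) w)⁻¹ ^ 2))
            (η : ContDiffHolderFunction ℂ F k r × ContDiffHolderFunction ℂ F k r) z) ∧
        (∀ w : ℂ, dbarAlong 1 (sec₁ (fun w : ℂ => ε * w ^ n)
          (R η : ContDiffHolderFunction ℂ F (k + 1) r × ContDiffHolderFunction ℂ F (k + 1) r)) w =
          sec₁ (fun w : ℂ => -(ε * w ^ n * ((starRingEnd ℂ) w)⁻¹ ^ 2))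
            (η : ContDiffHolderFunction ℂ F k r × ContDiffHolderFunction ℂ F k r) w) :=
  ⟨dbarRightInv ε hε n k hr0 hr1, fun η =>
    ⟨dbarAlong_sec₀_dbarRightInv ε hε n k hr0 hr1 η,
      dbarAlong_sec₁_dbarRightInv ε hε n k hr0 hr1 η⟩⟩

/-- **A bounded right inverse of `∂̄` on Hölder sections of `O(n)`**, for any pair of clutching
functions `τ = (w ↦ ε wⁿ)`, `τ' = (w ↦ -ε wⁿ (w̄)⁻²)` given as function equalities (transport of
`exists_dbar_rightInverse` to other syntactic forms of the clutchings).
[cite: Wendl2018, Prop. 2.53] -/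
theorem exists_dbar_rightInverse' {τ τ' : ℂ → ℂ} (ε : ℂ) (hε : ε ≠ 0) (n k : ℕ) (hr0 : 0 < r)
    (hr1 : r < 1) (hτ : τ = fun w : ℂ => ε * w ^ n)
    (hτ' : τ' = fun w : ℂ => -(ε * w ^ n * ((starRingEnd ℂ) w)⁻¹ ^ 2)) :
    ∃ R : holderSections F τ' k r →L[ℝ] holderSections F τ (k + 1) r,
      ∀ η, (∀ z : ℂ, dbarAlong 1 (sec₀ τ
          (R η : ContDiffHolderFunction ℂ F (k + 1) r × ContDiffHolderFunction ℂ F (k + 1) r)) z =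
          sec₀ τ' (η : ContDiffHolderFunction ℂ F k r × ContDiffHolderFunction ℂ F k r) z) ∧
        (∀ w : ℂ, dbarAlong 1 (sec₁ τ
          (R η : ContDiffHolderFunction ℂ F (k + 1) r × ContDiffHolderFunction ℂ F (k + 1) r)) w =
          sec₁ τ' (η : ContDiffHolderFunction ℂ F k r × ContDiffHolderFunction ℂ F k r) w) := by
  subst hτ hτ'
  exact exists_dbar_rightInverse ε hε n k hr0 hr1

/-- **Functions on the sphere (`τ = 1`, target `dbarClutch 1`): a bounded right inverse of `∂̄`**
`𝓗^{k,r}_{dbarClutch 1}(F) → 𝓗^{k+1,r}_1(F)`, in the syntactic forms of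
`Literature/Analysis/Complex/RiemannSphereDbar.lean` (the case `ε = 1`, `n = 0`).
[cite: Wendl2018, Prop. 2.53] -/
theorem exists_dbar_rightInverse_one (k : ℕ) (hr0 : 0 < r) (hr1 : r < 1) :
    ∃ R : holderSections F (dbarClutch 1) k r →L[ℝ] holderSections F (1 : ℂ → ℂ) (k + 1) r,
      ∀ η, (∀ z : ℂ, dbarAlong 1 (sec₀ (1 : ℂ → ℂ)
          (R η : ContDiffHolderFunction ℂ F (k + 1) r × ContDiffHolderFunction ℂ F (k + 1) r)) z =
          sec₀ (dbarClutch 1)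
            (η : ContDiffHolderFunction ℂ F k r × ContDiffHolderFunction ℂ F k r) z) ∧
        (∀ w : ℂ, dbarAlong 1 (sec₁ (1 : ℂ → ℂ)
          (R η : ContDiffHolderFunction ℂ F (k + 1) r × ContDiffHolderFunction ℂ F (k + 1) r)) w =
          sec₁ (dbarClutch 1)
            (η : ContDiffHolderFunction ℂ F k r × ContDiffHolderFunction ℂ F k r) w) :=
  exists_dbar_rightInverse' 1 one_ne_zero 0 k hr0 hr1 (by funext w; simp)
    (by funext w; simp [dbarClutch])

/-- **Vector fields on the sphere (`τ w = -w²`, target `dbarClutch (w ↦ -w²)`): a bounded right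
inverse of `∂̄`** `𝓗^{k,r}_{dbarClutch (-w²)}(F) → 𝓗^{k+1,r}_{-w²}(F)`, in the syntactic forms of
`Literature/Analysis/Complex/RiemannSphereDbar.lean` (the case `ε = -1`, `n = 2`).
[cite: Wendl2018, Prop. 2.53] -/
theorem exists_dbar_rightInverse_neg_sq (k : ℕ) (hr0 : 0 < r) (hr1 : r < 1) :
    ∃ R : holderSections F (dbarClutch fun w : ℂ => -w ^ 2) k r →L[ℝ]
        holderSections F (fun w : ℂ => -w ^ 2) (k + 1) r,
      ∀ η, (∀ z : ℂ, dbarAlong 1 (sec₀ (fun w : ℂ => -w ^ 2)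
          (R η : ContDiffHolderFunction ℂ F (k + 1) r × ContDiffHolderFunction ℂ F (k + 1) r)) z =
          sec₀ (dbarClutch fun w : ℂ => -w ^ 2)
            (η : ContDiffHolderFunction ℂ F k r × ContDiffHolderFunction ℂ F k r) z) ∧
        (∀ w : ℂ, dbarAlong 1 (sec₁ (fun w : ℂ => -w ^ 2)
          (R η : ContDiffHolderFunction ℂ F (k + 1) r × ContDiffHolderFunction ℂ F (k + 1) r)) w =
          sec₁ (dbarClutch fun w : ℂ => -w ^ 2)
            (η : ContDiffHolderFunction ℂ F k r × ContDiffHolderFunction ℂ F k r) w) :=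
  exists_dbar_rightInverse' (-1) (neg_ne_zero.2 one_ne_zero) 2 k hr0 hr1 (by funext w; ring)
    (by funext w; simp only [dbarClutch]; ring)

end RightInverse

end RiemannSphere

end Literature.Analysis.Complex

end
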